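import Summits.Ventures.HodgeRepro2.T5SU11ResolventGroundStateWeight
import Summits.Ventures.HodgeRepro2.T5SU11ImproperHardyRemainderClass
import Summits.Ventures.HodgeRepro2.T5SU11ResolventStrictPositivity
import Summits.Ventures.HodgeRepro2.T5SU11RadialGreenImproperUnique

/-!
# `G^I_λ g` on the ground-state weighted space `W_1`: the differential equation, the maximum principle and uniqueness

Since `W_1 = {g continuous on (0, ∞) : |g| ≤ D Ξ}` lies in the class for every `λ > 1` (row 556), the class results on
`u = G^I_λ g` hold on `W_1` with no decay hypothesis:

* `hasDerivAt_greenSolI_ground`, `hasDerivAt_greenSolI'_ground`, `greenSolI_ode_ground` — **`u = G^I_λ g` is `C²` on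
  `(0, ∞)` and solves `sinh 2t · u″ + 2 cosh 2t · u′ = μ sinh 2t · u + sinh 2t · g`**, i.e. `(L − μ) u = g` (rows 474, 535);
* `tendsto_greenSolI_div_sph_ground` — `u/φ_λ → 0` at infinity (row 4xx);
* `eq_greenSolI_of_ode_ground` — **uniqueness**: every `C²` solution of `(L − μ) v = g` on `(0, ∞)` that is bounded at the
  origin and `o(φ_λ)` at infinity is `G^I_λ g` (row 4xx);
* `greenSolI_neg_ground`, `greenSolI_pos_ground` — **the strong maximum principle**: `g ≥ 0`, `g(t₀) > 0` ⇒ `G^I_λ g < 0` on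
  `(0, ∞)` (row 541).

Nothing is claimed about (N).

Blind lane: Mathlib + the HodgeRepro2 prefix only; no sorry; axioms ⊆ {propext, Classical.choice,
Quot.sound}.
-/

namespace Summit.Ventures.HodgeRepro2.T5SU11WeightedSpaceGroundStateODE

open Filter Topology MeasureTheory
open Set (Ioi Ioc)
open T5SU11Cartan T5SU11SphericalFunction T5SU11SphericalDecay T5SU11SphericalSolutionSpaceAll T5SU11RadialGreenImproper
  T5SU11RadialGreenImproperUnique T5SU11ImproperHardyRemainderClass T5SU11ResolventStrictPositivity
  T5SU11ResolventGroundStateWeight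

section measure

variable [MeasurableSpace Circle] [BorelSpace Circle]

variable {lam : ℝ} (hlam : 1 < lam) {g : ℝ → ℝ} (hg : ContinuousOn g (Ioi 0))
  {D : ℝ} (hD : ∀ s, 0 < s → |g s| ≤ D * sph 1 (hyp s))

include hlam hg hD in
/-- **`u = G^I_λ g` is differentiable on `(0, ∞)`** with derivative `u′ = G^I_λ′ g` (`g ∈ W_1`). -/
theorem hasDerivAt_greenSolI_ground {t : ℝ} (ht : 0 < t) :
    HasDerivAt (greenSolI (fun t => sph lam (hyp t)) (sphDecay lam) g)
      (greenSolI' (deriv fun t => sph lam (hyp t)) (sphDecay' lam) (fun t => sph lam (hyp t)) (sphDecay lam) g t) t := by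
  obtain ⟨hM, hD0, hε, C, hC⟩ := class_of_le_mul_sph_one hlam hD
  exact hasDerivAt_greenSolI_class hlam hg hM hD0 hε hC ht

include hlam hg hD in
/-- **`u′` is differentiable on `(0, ∞)`** with derivative `u″` (`g ∈ W_1`). -/
theorem hasDerivAt_greenSolI'_ground {t : ℝ} (ht : 0 < t) :
    HasDerivAt (greenSolI' (deriv fun t => sph lam (hyp t)) (sphDecay' lam) (fun t => sph lam (hyp t)) (sphDecay lam) g)
      (greenSolI'' (deriv (deriv fun t => sph lam (hyp t))) (sphDecay'' lam) (deriv fun t => sph lam (hyp t))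
        (sphDecay' lam) (fun t => sph lam (hyp t)) (sphDecay lam) g t) t := by
  obtain ⟨hM, hD0, hε, C, hC⟩ := class_of_le_mul_sph_one hlam hD
  exact hasDerivAt_greenSolI'_class hlam hg hM hD0 hε hC ht

include hlam in
/-- **`u = G^I_λ g` solves `(L − μ) u = g`**: `sinh 2t · u″ + 2 cosh 2t · u′ = λ(λ − 2) sinh 2t · u + sinh 2t · g` on `(0, ∞)`. -/
theorem greenSolI_ode_ground {t : ℝ} (ht : 0 < t) :
    Real.sinh (2 * t) * greenSolI'' (deriv (deriv fun t => sph lam (hyp t))) (sphDecay'' lam)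
        (deriv fun t => sph lam (hyp t)) (sphDecay' lam) (fun t => sph lam (hyp t)) (sphDecay lam) g t
      + 2 * Real.cosh (2 * t) * greenSolI' (deriv fun t => sph lam (hyp t)) (sphDecay' lam)
        (fun t => sph lam (hyp t)) (sphDecay lam) g t
      = lam * (lam - 2) * Real.sinh (2 * t) * greenSolI (fun t => sph lam (hyp t)) (sphDecay lam) g t
        + Real.sinh (2 * t) * g t :=
  greenSolI_ode (hode_sph lam) (fun _ hs => sphDecay_ode hlam hs) (fun _ hs => wronskian_sphDecay hlam hs) (g := g) ht

include hlam hg hD in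
/-- **`u/φ_λ → 0` at infinity** for `g ∈ W_1`. -/
theorem tendsto_greenSolI_div_sph_ground :
    Tendsto (fun t => greenSolI (fun t => sph lam (hyp t)) (sphDecay lam) g t / sph lam (hyp t)) atTop (𝓝 0) := by
  obtain ⟨hM, hD0, hε, C, hC⟩ := class_of_le_mul_sph_one hlam hD
  exact tendsto_greenSolI_div_atTop hlam hg hM hD0 hε hC

include hlam hg hD in
/-- **UNIQUENESS ON `W_1`**: every `C²` solution `v` of `sinh 2t · v″ + 2 cosh 2t · v′ = λ(λ − 2) sinh 2t · v + sinh 2t · g` on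
`(0, ∞)` that is bounded at the origin and `o(φ_λ)` at infinity equals `G^I_λ g`. -/
theorem eq_greenSolI_of_ode_ground {v v' v'' : ℝ → ℝ}
    (hv : ∀ t, 0 < t → HasDerivAt v (v' t) t) (hv' : ∀ t, 0 < t → HasDerivAt v' (v'' t) t)
    (hvode : ∀ t, 0 < t → Real.sinh (2 * t) * v'' t + 2 * Real.cosh (2 * t) * v' t
      = lam * (lam - 2) * Real.sinh (2 * t) * v t + Real.sinh (2 * t) * g t)
    {B : ℝ} (hB : ∀ᶠ t in 𝓝[>] (0 : ℝ), |v t| ≤ B)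
    (hdecay : Tendsto (fun t => v t / sph lam (hyp t)) atTop (𝓝 0)) {t : ℝ} (ht : 0 < t) :
    v t = greenSolI (fun t => sph lam (hyp t)) (sphDecay lam) g t := by
  obtain ⟨hM, hD0, hε, C, hC⟩ := class_of_le_mul_sph_one hlam hD
  exact eq_greenSolI_of_ode hlam hg hM hD0 hε hC hv hv' hvode hB hdecay ht

include hlam hg hD in
/-- **THE STRONG MAXIMUM PRINCIPLE ON `W_1`**: `g ≥ 0` on `(0, ∞)` with `g(t₀) > 0` ⇒ `G^I_λ g(t) < 0` for every `t > 0`. -/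
theorem greenSolI_neg_ground (hg0 : ∀ s, 0 < s → 0 ≤ g s) {t₀ : ℝ} (ht₀ : 0 < t₀) (hgt₀ : 0 < g t₀)
    {t : ℝ} (ht : 0 < t) : greenSolI (fun t => sph lam (hyp t)) (sphDecay lam) g t < 0 := by
  obtain ⟨hM, hD0, hε, C, hC⟩ := class_of_le_mul_sph_one hlam hD
  exact greenSolI_neg hlam hg hM hD0 hε hC hg0 ht₀ hgt₀ ht

include hlam hg hD in
/-- `g ≤ 0` on `(0, ∞)` with `g(t₀) < 0` ⇒ `G^I_λ g(t) > 0` for every `t > 0` (`g ∈ W_1`). -/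
theorem greenSolI_pos_ground (hg0 : ∀ s, 0 < s → g s ≤ 0) {t₀ : ℝ} (ht₀ : 0 < t₀) (hgt₀ : g t₀ < 0)
    {t : ℝ} (ht : 0 < t) : 0 < greenSolI (fun t => sph lam (hyp t)) (sphDecay lam) g t := by
  obtain ⟨hM, hD0, hε, C, hC⟩ := class_of_le_mul_sph_one hlam hD
  exact greenSolI_pos hlam hg hM hD0 hε hC hg0 ht₀ hgt₀ ht

end measure

end Summit.Ventures.HodgeRepro2.T5SU11WeightedSpaceGroundStateODE
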